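import Mathlib
import HarnessLib
import Summits.NavierStokesRegularity.NavierStokesRegularity.Theorems.UnthreadedDoorNetFluxOneSidedLawCalculus
import Summits.NavierStokesRegularity.NavierStokesRegularity.Theorems.UnthreadedDoorCapSymHeadPotential

/-!
# Route `UnthreadedDoor`, crux `PoloidalLiouville` (stmt-NavierStokesRegularity-1222), WALL W1 `stub_scalarLiouville` —
# crux idea «netflux-typei-gap» (ns-idea-14, LINE v7 0e37b0e5ff94): NF-1cᵛ `stub_oneSidedLaw_of_hinges` — THE POINTWISE SLICE INEQUALITY

Second of three files proving the line's NF-1cᵛ stub (`…OneSidedLawCalculus` ⟶ this file ⟶ `…OneSidedLaw`).  Here: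
* `exists_headPotential` — the head `P(t,·) ∈ C¹(ℝ³ ∖ {x₀})` of the window, slice by slice, from `CapSym.headPotentialExists` (FL-A,
  p650918; `CurledLaw` is literally its hypothesis, the regularity is `contDiffOn_windowOperator`): the head relation
  `(∂ₜT + ⟪v,∇T⟫ − ΔT)·(x − x₀) = ⟪v, x − x₀⟫∇T − ∇P`;
* `netFlux_sub_netFlux_le_pointwise` — **the pointwise inequality of the Lines docstring «Derivation of (L)»** on `r ∈ [a,R]`:
  `w(t,r) − w(s,r) ≤ h·(Δ²_k w(t,·)(r)/k² + 2Mk − (sup_{argmax_{S_r}T}∂_rP − inf_{argmin_{S_r}T}∂_rP)) + 2RM₂h²` (`h = t − s`), from: extremisers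
  `x̂±` attaining the `sup`/`inf` of `∂_rP` (compact argmax/argmin, `P ∈ C¹`), the time comparison `netFlux_sub_netFlux_le_of_extremisers`,
  Taylor in time with the named constant `M₂`, the EXACT slice identity `∂ₜT = ΔT − ∂_rP/r` at extremisers (`slice_identity_of_radial` + radial
  derivative at a spherical extremiser), `Δ ≤ ∂_r² + (2/r)∂_r` at a max / `≥` at a min (p669437), and the second-difference touching bounds
  (E)(c) (p667268) — whose `F⁺ − F⁻` second differences are those of `w = ρ·sphSup − ρ·sphInf`.

WHAT THIS IS NOT: no NS-regularity statement is touched; SUPPORT for the line's NF-1cᵛ stub (closed in `…OneSidedLaw`); NF-1a, `PoloidalLiouville`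
(1222), W1, the rung target and the summit stay OPEN.  `--supports stmt-NavierStokesRegularity-1222 --as helper`.  [folklore]
-/

noncomputable section

-- the summit and its single sub-problem share the name (CONVENTIONS §1)
set_option linter.dupNamespace false

open Set Function Filter Topology InnerProductSpace MeasureTheory
open scoped RealInnerProductSpace ContDiff NNReal

namespace Summit.NavierStokesRegularity.NavierStokesRegularity.Theorems.PoloidalLiouville.NetFlux

open Literature.Analysis Literature.Analysis.FluidPDE

variable {v : ℝ → E3 → E3} {T : ℝ → E3 → ℝ} {x₀ : E3} {t₀ : ℝ} {V : ℝ → ℝ}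

/-! ### The head potential on the window (FL-A by name, slice by slice) -/

/-- **The head potential of the window**: for `v` smooth on the window, `T` smooth off the centre and `CurledLaw`, there is
`P(t,·) ∈ C¹(ℝ³ ∖ {x₀})` with the head relation `(∂ₜT + ⟪v,∇T⟫ − ΔT)·(x − x₀) = ⟪v, x − x₀⟫ ∇T − ∇P` on every slice of the window
(`CapSym.headPotentialExists`, p650918, applied at each `t`). [folklore] -/
theorem exists_headPotential (hv : ContDiffOn ℝ (⊤ : ℕ∞) (uncurry v) (Ioo t₀ 0 ×ˢ (univ : Set E3)))
    (hT : ContDiffOn ℝ (⊤ : ℕ∞) (uncurry T) (Ioo t₀ 0 ×ˢ ({x₀}ᶜ : Set E3))) (hE1 : CurledLaw v x₀ T (Ioo t₀ 0)) :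
    ∃ P : ℝ → E3 → ℝ, (∀ t ∈ Ioo t₀ 0, ContDiffOn ℝ 1 (P t) ({x₀}ᶜ : Set E3)) ∧
      ∀ t ∈ Ioo t₀ 0, ∀ x, x ≠ x₀ →
        (deriv (fun s => T s x) t + ⟪v t x, gradient (T t) x⟫ - Laplacian.laplacian (T t) x) • (x - x₀)
          = ⟪v t x, x - x₀⟫ • gradient (T t) x - gradient (P t) x := by
  have key : ∀ t : ℝ, ∃ Pt : E3 → ℝ, t ∈ Ioo t₀ 0 →
      (ContDiffOn ℝ 1 Pt ({x₀}ᶜ : Set E3) ∧ ∀ x, x ≠ x₀ →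
        (deriv (fun s => T s x) t + ⟪v t x, gradient (T t) x⟫ - Laplacian.laplacian (T t) x) • (x - x₀)
          = ⟪v t x, x - x₀⟫ • gradient (T t) x - gradient Pt x) := by
    intro t
    by_cases ht : t ∈ Ioo t₀ 0
    · obtain ⟨Pt, hPt, hhead⟩ := CapSym.headPotentialExists x₀
        (fun z => deriv (fun s => T s z) t + ⟪v t z, gradient (T t) z⟫ - Laplacian.laplacian (T t) z)
        (fun z => ⟪v t z, z - x₀⟫) (T t) (contDiffOn_windowOperator hv hT ht) (contDiff_radialMomentum hv ht x₀)
        (contDiffOn_two_slice_compl hT ht) (hE1 t ht)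
      exact ⟨Pt, fun _ => ⟨hPt, hhead⟩⟩
    · exact ⟨fun _ => 0, fun h => absurd h ht⟩
  choose P hP using key
  exact ⟨P, fun t ht => (hP t ht).1, fun t ht => (hP t ht).2⟩

/-! ### The pointwise slice inequality on `[a, R]` -/

/-- **The pointwise inequality of derivation (L)**: with the head relation at time `t`, the time-Taylor bound with constant `M₂` between
the slices `t` and `s` (`h = t − s`), and the second-difference touching bounds (E)(c) at radius `r ∈ [a,R]` with constants `M, k`:
`w(t,r) − w(s,r) ≤ h·(Δ²_k w(t,·)(r)/k² + 2Mk − (sup_{argmax}∂_rP − inf_{argmin}∂_rP)) + 2RM₂h²`.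
Ingredients: extremisers attaining the `sup`/`inf` of `∂_rP`, `netFlux_sub_netFlux_le_of_extremisers`, `slice_identity_of_radial`,
`laplacian_le_of_mem_sphArgmax` / `le_laplacian_of_mem_sphArgmin`. [folklore] -/
theorem netFlux_sub_netFlux_le_pointwise
    (hT : ContDiffOn ℝ (⊤ : ℕ∞) (uncurry T) (Ioo t₀ 0 ×ˢ ({x₀}ᶜ : Set E3)))
    {P : ℝ → E3 → ℝ} {t s : ℝ} (ht : t ∈ Ioo t₀ 0) (hs : s ∈ Ioo t₀ 0)
    (hP1 : ContDiffOn ℝ 1 (P t) ({x₀}ᶜ : Set E3))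
    (hhead : ∀ x, x ≠ x₀ →
        (deriv (fun σ => T σ x) t + ⟪v t x, gradient (T t) x⟫ - Laplacian.laplacian (T t) x) • (x - x₀)
          = ⟪v t x, x - x₀⟫ • gradient (T t) x - gradient (P t) x)
    {a R h M₂ M k : ℝ} (ha : 0 < a) (hh : 0 < h) (hM₂ : 0 ≤ M₂)
    (htaylor : ∀ x : E3, ‖x - x₀‖ ∈ Icc a R → |T t x - T s x - h * deriv (fun σ => T σ x) t| ≤ M₂ * h ^ 2)
    {r : ℝ} (hr : r ∈ Icc a R)
    (hEsup : ∀ x ∈ sphArgmax (T t) x₀ r,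
        r * radDeriv2 (T t) x₀ x + 2 * radDeriv (T t) x₀ x
          ≤ ((r + k) * sphSup (T t) x₀ (r + k) - 2 * (r * sphSup (T t) x₀ r)
              + (r - k) * sphSup (T t) x₀ (r - k)) / k ^ 2 + M * k)
    (hEinf : ∀ x ∈ sphArgmin (T t) x₀ r,
        ((r + k) * sphInf (T t) x₀ (r + k) - 2 * (r * sphInf (T t) x₀ r)
            + (r - k) * sphInf (T t) x₀ (r - k)) / k ^ 2 - M * k
          ≤ r * radDeriv2 (T t) x₀ x + 2 * radDeriv (T t) x₀ x) :
    netFlux (T t) x₀ r - netFlux (T s) x₀ r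
      ≤ h * ((netFlux (T t) x₀ (r + k) - 2 * netFlux (T t) x₀ r + netFlux (T t) x₀ (r - k)) / k ^ 2 + 2 * M * k
              - (sSup (radDeriv (P t) x₀ '' sphArgmax (T t) x₀ r) - sInf (radDeriv (P t) x₀ '' sphArgmin (T t) x₀ r)))
        + 2 * R * M₂ * h ^ 2 := by
  have hO : IsOpen ({x₀}ᶜ : Set E3) := isOpen_compl_singleton
  have hr0 : 0 < r := ha.trans_le hr.1
  have hrR : r ≤ R := hr.2
  have hTt : ContDiffOn ℝ (⊤ : ℕ∞) (T t) ({x₀}ᶜ) := contDiffOn_slice_compl hT ht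
  have hTs : ContDiffOn ℝ (⊤ : ℕ∞) (T s) ({x₀}ᶜ) := contDiffOn_slice_compl hT hs
  have hTtc : ContinuousOn (T t) ({x₀}ᶜ) := hTt.continuousOn
  have hTtS : ContinuousOn (T t) (Metric.sphere x₀ r) := continuousOn_sphere_of_continuousOn_compl hTtc hr0
  have hTsS : ContinuousOn (T s) (Metric.sphere x₀ r) := continuousOn_sphere_of_continuousOn_compl hTs.continuousOn hr0
  have hPc : ContinuousOn (radDeriv (P t) x₀) ({x₀}ᶜ) := continuousOn_radDeriv_of_contDiffOn hP1
  have hTd : ∀ y : E3, y ≠ x₀ → DifferentiableAt ℝ (T t) y := fun y hy =>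
    (hTt.differentiableOn (by simp) y hy).differentiableAt (hO.mem_nhds hy)
  have hPd : ∀ y : E3, y ≠ x₀ → DifferentiableAt ℝ (P t) y := fun y hy =>
    (hP1.differentiableOn one_ne_zero y hy).differentiableAt (hO.mem_nhds hy)
  -- extremisers attaining `sup ∂_rP` over the argmax and `inf ∂_rP` over the argmin
  obtain ⟨⟨xp, hxp, hsup⟩, -⟩ := exists_mem_sphArgmax_sSup_eq hr0 hTtc hPc
  obtain ⟨⟨xm, hxm, hinf⟩, -⟩ := exists_mem_sphArgmin_sInf_eq hr0 hTtc hPc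
  have hxpS : xp ∈ Metric.sphere x₀ r := hxp.1
  have hxmS : xm ∈ Metric.sphere x₀ r := hxm.1
  have hxpne : xp ≠ x₀ := ne_center_of_mem_sphere hr0 hxpS
  have hxmne : xm ≠ x₀ := ne_center_of_mem_sphere hr0 hxmS
  have hxpn : ‖xp - x₀‖ = r := mem_sphere_iff_norm.1 hxpS
  have hxmn : ‖xm - x₀‖ = r := mem_sphere_iff_norm.1 hxmS
  -- (1) time comparison at the extremisers
  have h1 := netFlux_sub_netFlux_le_of_extremisers hr0.le hTtS hTsS hxp hxm
  -- (2) Taylor in time at `xp`, `xm`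
  have h2p := htaylor xp (by rw [hxpn]; exact hr)
  have h2m := htaylor xm (by rw [hxmn]; exact hr)
  rw [abs_le] at h2p h2m
  -- (3) the exact slice identity at the extremisers
  have h3p : deriv (fun σ => T σ xp) t = Laplacian.laplacian (T t) xp - radDeriv (P t) x₀ xp / r := by
    have h := slice_identity_of_radial hr0 hxpS (hPd xp hxpne)
      (fderiv_eq_inner_mul_radDeriv_of_mem_sphArgmax hr0 (hTd xp hxpne) hxp) (hhead xp hxpne)
    linarith
  have h3m : deriv (fun σ => T σ xm) t = Laplacian.laplacian (T t) xm - radDeriv (P t) x₀ xm / r := by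
    have h := slice_identity_of_radial hr0 hxmS (hPd xm hxmne)
      (fderiv_eq_inner_mul_radDeriv_of_mem_sphArgmin hr0 (hTd xm hxmne) hxm) (hhead xm hxmne)
    linarith
  -- (4) the Laplacian at a spherical max / min
  have h4p := laplacian_le_of_mem_sphArgmax hr0 hTt hxp
  have h4m := le_laplacian_of_mem_sphArgmin hr0 hTt hxm
  -- (5) the touching bounds at these extremisers
  have h5p := hEsup xp hxp
  have h5m := hEinf xm hxm
  -- `r ∂ₜT(x̂⁺) ≤ r ∂_r²T + 2 ∂_rT − ∂_rP` at `x̂⁺`, and the reverse at `x̂⁻`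
  have ep : r * (radDeriv (P t) x₀ xp / r) = radDeriv (P t) x₀ xp := by field_simp
  have em : r * (radDeriv (P t) x₀ xm / r) = radDeriv (P t) x₀ xm := by field_simp
  have ep2 : r * (2 / r * radDeriv (T t) x₀ xp) = 2 * radDeriv (T t) x₀ xp := by field_simp
  have em2 : r * (2 / r * radDeriv (T t) x₀ xm) = 2 * radDeriv (T t) x₀ xm := by field_simp
  have hTp : r * deriv (fun σ => T σ xp) t
      ≤ r * radDeriv2 (T t) x₀ xp + 2 * radDeriv (T t) x₀ xp - radDeriv (P t) x₀ xp := by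
    have h := mul_le_mul_of_nonneg_left h4p hr0.le
    rw [mul_add, ep2] at h
    rw [h3p, mul_sub, ep]
    linarith
  have hTm : r * radDeriv2 (T t) x₀ xm + 2 * radDeriv (T t) x₀ xm - radDeriv (P t) x₀ xm
      ≤ r * deriv (fun σ => T σ xm) t := by
    have h := mul_le_mul_of_nonneg_left h4m hr0.le
    rw [mul_add, em2] at h
    rw [h3m, mul_sub, em]
    linarith
  -- the second differences of `F⁺ − F⁻` are those of `w`
  have e3 : ((r + k) * sphSup (T t) x₀ (r + k) - 2 * (r * sphSup (T t) x₀ r) + (r - k) * sphSup (T t) x₀ (r - k)) / k ^ 2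
        - ((r + k) * sphInf (T t) x₀ (r + k) - 2 * (r * sphInf (T t) x₀ r) + (r - k) * sphInf (T t) x₀ (r - k)) / k ^ 2
      = (netFlux (T t) x₀ (r + k) - 2 * netFlux (T t) x₀ r + netFlux (T t) x₀ (r - k)) / k ^ 2 := by
    unfold netFlux sphOsc
    rw [← sub_div]
    congr 1
    ring
  -- assemble
  have hA : (T t xp - T s xp) - (T t xm - T s xm)
      ≤ h * (deriv (fun σ => T σ xp) t - deriv (fun σ => T σ xm) t) + 2 * M₂ * h ^ 2 := by
    linarith [h2p.2, h2m.1]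
  have hB := h1.trans (mul_le_mul_of_nonneg_left hA hr0.le)
  have hC : r * deriv (fun σ => T σ xp) t - r * deriv (fun σ => T σ xm) t
      ≤ (netFlux (T t) x₀ (r + k) - 2 * netFlux (T t) x₀ r + netFlux (T t) x₀ (r - k)) / k ^ 2 + 2 * M * k
          - (radDeriv (P t) x₀ xp - radDeriv (P t) x₀ xm) := by
    rw [← e3]
    linarith [hTp, hTm, h5p, h5m]
  have hD : r * (h * (deriv (fun σ => T σ xp) t - deriv (fun σ => T σ xm) t) + 2 * M₂ * h ^ 2)
      = h * (r * deriv (fun σ => T σ xp) t - r * deriv (fun σ => T σ xm) t) + 2 * r * M₂ * h ^ 2 := by ring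
  rw [hD] at hB
  have hE : 2 * r * M₂ * h ^ 2 ≤ 2 * R * M₂ * h ^ 2 := by
    have h0 : 0 ≤ 2 * M₂ * h ^ 2 := mul_nonneg (mul_nonneg two_pos.le hM₂) (sq_nonneg h)
    nlinarith [h0, hrR]
  have hF := mul_le_mul_of_nonneg_left hC hh.le
  rw [hsup, hinf]
  linarith [hB, hE, hF]

end Summit.NavierStokesRegularity.NavierStokesRegularity.Theorems.PoloidalLiouville.NetFlux

end
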